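import Mathlib
import Summits.Ventures.PercRepro.TriangleCapRowA1

/-!
# PercRepro — THE CELL `(k, a, a + 2)`: THE TRIPLE BROOM ATTAINS THE GAP `2k + 2a − 14` (p3, gen 47; part 200zi)

The witness of the conjectured gap of the cell `r = a + 2` (§10cd(a): `2 (k − a − 3) + 2 (r − a)(a − 2)`): the double
broom of part 200w minus one more pair `{1, a + 3}` at the vertex `1` — `K_{a+1,k−a−1}` minus a `(k − a − 2)`-star at
`0` minus a `3`-star at `1` sharing leaves with it — is `K₄⁻`-free, has `a (k − a) − (a + 2)` edges, is
`a`-bipartite for no `A`, and has `Σ_v d(v)² + (a + 2)(k − 1 − (a + 2)) + (2k + 2a − 14) = m k` (`4 ≤ a`,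
`3a + 1 ≤ k`). The one-triangle family `tFamilyGen (k − 1) a 4` lies `2k + 4a − 26` below the closed form, so the
triple broom is the better non-`a`-bipartite graph for `a ≥ 7` (they tie at `a = 6`). Axioms: standard.
-/

namespace PercRepro

namespace TriangleCap

namespace C047

open Finset

/-- **THE TRIPLE BROOM** on `Fin k`: the double broom minus the pair `{1, a + 3}`. -/
abbrev tripleBroom (k a : ℕ) (h1 : 1 < k) (hak : a + 1 < k) (hak2 : a + 2 < k) (hak3 : a + 3 < k) :
    SimpleGraph (Fin k) :=
  delEdge (doubleBroom k a h1 hak hak2) ⟨1, h1⟩ ⟨a + 3, hak3⟩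

/-- **THE TRIPLE BROOM ON `(k, a, a + 2)`:** `K₄⁻`-free with `a (k − a) − (a + 2)` edges, `a`-bipartite for no `A`,
and `Σ_v d(v)² + (a + 2)(k − 1 − (a + 2)) + (2k + 2a − 14) = m k` (`4 ≤ a`, `3a + 1 ≤ k`). -/
theorem rowA2_witness (k a : ℕ) (ha4 : 4 ≤ a) (hk : 3 * a + 1 ≤ k) (h1 : 1 < k) (hak : a + 1 < k)
    (hak2 : a + 2 < k) (hak3 : a + 3 < k) :
    K4mFree (tripleBroom k a h1 hak hak2 hak3) ∧
      (tripleBroom k a h1 hak hak2 hak3).edgeFinset.card + (a + 2) = a * (k - a) ∧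
      (¬ ∃ A : Finset (Fin k), A.card = a ∧ BipSub (tripleBroom k a h1 hak hak2 hak3) A) ∧
      ∑ v, deg (tripleBroom k a h1 hak hak2 hak3) v * deg (tripleBroom k a h1 hak hak2 hak3) v +
          (a + 2) * (k - 1 - (a + 2)) + (2 * k + 2 * a - 14) =
        (tripleBroom k a h1 hak hak2 hak3).edgeFinset.card * k := by
  have hk0 : 0 < k := by omega
  unfold tripleBroom
  obtain ⟨hK, hE, -, hS⟩ := rowA1_witness k a ha4 hk h1 hak hak2
  -- the pairs `{1, a + 1}`, `{1, a + 2}`, `{1, a + 3}` in the bipartite graph and after the deletions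
  have hadj1 : (bipMinusStar k (a + 1) (k - a - 2)).Adj ⟨1, h1⟩ ⟨a + 1, hak⟩ := by
    rw [bipMinusStar_adj]
    simp only
    refine ⟨?_, ?_⟩
    · rw [Xor]; omega
    · omega
  have hadj2 : (bipMinusStar k (a + 1) (k - a - 2)).Adj ⟨1, h1⟩ ⟨a + 2, hak2⟩ := by
    rw [bipMinusStar_adj]
    simp only
    refine ⟨?_, ?_⟩
    · rw [Xor]; omega
    · omega
  have hadj2' : (delEdge (bipMinusStar k (a + 1) (k - a - 2)) ⟨1, h1⟩ ⟨a + 1, hak⟩).Adj ⟨1, h1⟩ ⟨a + 2, hak2⟩ := by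
    rw [delEdge_adj]
    refine ⟨hadj2, ?_⟩
    simp only [Fin.ext_iff]
    omega
  have hb3 : (bipMinusStar k (a + 1) (k - a - 2)).Adj ⟨1, h1⟩ ⟨a + 3, hak3⟩ := by
    rw [bipMinusStar_adj]
    simp only
    refine ⟨?_, ?_⟩
    · rw [Xor]; omega
    · omega
  have hadj3 : (doubleBroom k a h1 hak hak2).Adj ⟨1, h1⟩ ⟨a + 3, hak3⟩ := by
    unfold doubleBroom
    rw [delEdge_adj, delEdge_adj]
    refine ⟨⟨hb3, ?_⟩, ?_⟩
    · simp only [Fin.ext_iff]; omega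
    · simp only [Fin.ext_iff]; omega
  -- the degrees of `1` and `a + 3` in the double broom
  have hd1 : deg (bipMinusStar k (a + 1) (k - a - 2)) ⟨1, h1⟩ = k - (a + 1) :=
    deg_bipMinusStar_small k (a + 1) (k - a - 2) (by omega) (by omega) 1 (le_refl 1) (by omega)
  have hda3 : deg (bipMinusStar k (a + 1) (k - a - 2)) ⟨a + 3, hak3⟩ = a := by
    rw [deg_bipMinusStar k (a + 1) (k - a - 2) (by omega) (by omega)]
    have h0 : (⟨a + 3, hak3⟩ : Fin k).val ≠ 0 := by simp only; omega
    have hst : (⟨a + 3, hak3⟩ : Fin k) ∈ rightStar k (a + 1) (k - a - 2) := by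
      rw [rightStar, mem_filter]
      simp only [mem_univ, true_and]
      omega
    rw [if_neg h0, if_pos hst]
    omega
  have hdd : ∀ v, deg (doubleBroom k a h1 hak hak2) v =
      deg (delEdge (delEdge (bipMinusStar k (a + 1) (k - a - 2)) ⟨1, h1⟩ ⟨a + 1, hak⟩) ⟨1, h1⟩ ⟨a + 2, hak2⟩) v :=
    fun _ => rfl
  have hd1'' : deg (doubleBroom k a h1 hak hak2) ⟨1, h1⟩ = k - (a + 1) - 2 := by
    rw [hdd]
    have h := deg_delEdge (delEdge (bipMinusStar k (a + 1) (k - a - 2)) ⟨1, h1⟩ ⟨a + 1, hak⟩) hadj2' ⟨1, h1⟩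
    have h' := deg_delEdge (bipMinusStar k (a + 1) (k - a - 2)) hadj1 ⟨1, h1⟩
    rw [if_pos (Or.inl rfl)] at h h'
    rw [hd1] at h'
    omega
  have hda3'' : deg (doubleBroom k a h1 hak hak2) ⟨a + 3, hak3⟩ = a := by
    rw [hdd]
    have h := deg_delEdge (delEdge (bipMinusStar k (a + 1) (k - a - 2)) ⟨1, h1⟩ ⟨a + 1, hak⟩) hadj2' ⟨a + 3, hak3⟩
    have h' := deg_delEdge (bipMinusStar k (a + 1) (k - a - 2)) hadj1 ⟨a + 3, hak3⟩
    have hne : ¬ ((⟨a + 3, hak3⟩ : Fin k) = ⟨1, h1⟩ ∨ (⟨a + 3, hak3⟩ : Fin k) = ⟨a + 1, hak⟩) := by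
      simp only [Fin.ext_iff]
      omega
    have hne' : ¬ ((⟨a + 3, hak3⟩ : Fin k) = ⟨1, h1⟩ ∨ (⟨a + 3, hak3⟩ : Fin k) = ⟨a + 2, hak2⟩) := by
      simp only [Fin.ext_iff]
      omega
    rw [if_neg hne, add_zero, hda3] at h'
    rw [if_neg hne', add_zero, h'] at h
    exact h
  have hE3 := card_edges_delEdge (doubleBroom k a h1 hak hak2) hadj3
  have hS3 := sum_deg_sq_delEdge (doubleBroom k a h1 hak hak2) hadj3
  rw [hd1'', hda3''] at hS3
  refine ⟨k4mFree_of_le _ _ (delEdge_le _ _ _) hK, by omega, ?_, ?_⟩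
  · -- not `a`-bipartite: the vertices `1, …, a` have degree `≥ a + 1`
    rintro ⟨A, hA, hB⟩
    have hin : ∀ v : Fin k, 1 ≤ v.val → v.val ≤ a → v ∈ A := by
      intro v hv1 hva
      by_contra hvA
      have hle := deg_le_card_of_bipSub _ A hB v hvA
      have hdel3 := deg_delEdge (doubleBroom k a h1 hak hak2) hadj3 v
      rw [hdd] at hdel3
      have hdel1 := deg_delEdge (bipMinusStar k (a + 1) (k - a - 2)) hadj1 v
      have hdel2 := deg_delEdge (delEdge (bipMinusStar k (a + 1) (k - a - 2)) ⟨1, h1⟩ ⟨a + 1, hak⟩) hadj2' v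
      have hdeg : deg (bipMinusStar k (a + 1) (k - a - 2)) v = k - (a + 1) := by
        have := deg_bipMinusStar_small k (a + 1) (k - a - 2) (by omega) (by omega) v.val hv1 (by omega)
        convert this
      rw [hA] at hle
      rw [hdeg] at hdel1
      have hif1 : (if v = (⟨1, h1⟩ : Fin k) ∨ v = ⟨a + 1, hak⟩ then 1 else 0) ≤ 1 := by split_ifs <;> omega
      have hif2 : (if v = (⟨1, h1⟩ : Fin k) ∨ v = ⟨a + 2, hak2⟩ then 1 else 0) ≤ 1 := by split_ifs <;> omega
      have hif3 : (if v = (⟨1, h1⟩ : Fin k) ∨ v = ⟨a + 3, hak3⟩ then 1 else 0) ≤ 1 := by split_ifs <;> omega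
      omega
    obtain ⟨S, hSdef⟩ : ∃ S : Finset (Fin k), S = Icc ⟨1, by omega⟩ ⟨a, by omega⟩ := ⟨_, rfl⟩
    have hmemS : ∀ v : Fin k, v ∈ S ↔ 1 ≤ v.val ∧ v.val ≤ a := by
      intro v
      rw [hSdef, mem_Icc, Fin.le_def, Fin.le_def]
    have hScard : S.card = a := by
      rw [hSdef, Fin.card_Icc]
      simp only
      omega
    have hsub : S ⊆ A := fun v hv => hin v ((hmemS v).mp hv).1 ((hmemS v).mp hv).2
    have hSA : S = A := eq_of_subset_of_card_le hsub (by rw [hA, hScard])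
    have h0 : (⟨0, hk0⟩ : Fin k) ∉ A := by
      rw [← hSA, hmemS]
      simp only
      omega
    have hlast : (⟨k - 1, by omega⟩ : Fin k) ∉ A := by
      rw [← hSA, hmemS]
      simp only
      omega
    have hadj0 : (delEdge (doubleBroom k a h1 hak hak2) ⟨1, h1⟩ ⟨a + 3, hak3⟩).Adj ⟨0, hk0⟩ ⟨k - 1, by omega⟩ := by
      unfold doubleBroom
      rw [delEdge_adj, delEdge_adj, delEdge_adj]
      refine ⟨⟨⟨?_, ?_⟩, ?_⟩, ?_⟩
      · rw [bipMinusStar_adj]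
        simp only
        refine ⟨?_, ?_⟩
        · rw [Xor]; omega
        · omega
      · simp only [Fin.ext_iff]; omega
      · simp only [Fin.ext_iff]; omega
      · simp only [Fin.ext_iff]; omega
    have := hB _ _ hadj0
    tauto
  · -- the value
    generalize hS3' : ∑ v, deg (delEdge (doubleBroom k a h1 hak hak2) ⟨1, h1⟩ ⟨a + 3, hak3⟩) v *
      deg (delEdge (doubleBroom k a h1 hak hak2) ⟨1, h1⟩ ⟨a + 3, hak3⟩) v = S3 at hS3 ⊢
    generalize hE3' : (delEdge (doubleBroom k a h1 hak hak2) ⟨1, h1⟩ ⟨a + 3, hak3⟩).edgeFinset.card = E3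
      at hE3 ⊢
    generalize hS2' : ∑ v, deg (doubleBroom k a h1 hak hak2) v * deg (doubleBroom k a h1 hak hak2) v = S2
      at hS hS3
    generalize hE2' : (doubleBroom k a h1 hak hak2).edgeFinset.card = E2 at hE hS hE3
    obtain ⟨q, rfl⟩ : ∃ q, a = q + 4 := ⟨a - 4, by omega⟩
    obtain ⟨c, rfl⟩ : ∃ c, k = 3 * (q + 4) + 1 + c := ⟨k - (3 * (q + 4) + 1), by omega⟩
    have e1 : 3 * (q + 4) + 1 + c - 1 - (q + 4 + 1) = 2 * q + 7 + c := by omega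
    have e2 : 2 * (3 * (q + 4) + 1 + c) - 10 = 6 * q + 16 + 2 * c := by omega
    have e3 : 3 * (q + 4) + 1 + c - (q + 4 + 1) - 2 = 2 * q + 6 + c := by omega
    have e4 : 3 * (q + 4) + 1 + c - 1 - (q + 4 + 2) = 2 * q + 6 + c := by omega
    have e5 : 2 * (3 * (q + 4) + 1 + c) + 2 * (q + 4) - 14 = 8 * q + 20 + 2 * c := by omega
    rw [e1, e2] at hS
    rw [e3] at hS3
    rw [e4, e5]
    zify at hS hS3 hE3 ⊢
    linear_combination hS3 + hS - (3 * ((q : ℤ) + 4) + 1 + c) * hE3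

end C047

end TriangleCap

end PercRepro
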